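import Summits.QuantumFields.YangMills.Theorems.BalabanUVNodesN07AliasSumMarginCore
import Summits.QuantumFields.YangMills.Theorems.BalabanUVNodesN07AliasSumPositivity
import Literature.MathematicalPhysics.QuantumFieldTheory.King1986.AliasingIdentity
import HarnessLib

/-!
# DAG node N07 (road R0′ at the record; the `hker` ∕ `hpos` letter) — THE EXPLICIT ONE-LEVEL MARGIN, part 2:
# «`K₀(θ) ≤ π^{|J|} · K(θ)`» — the block-MEAN symbol against the CENTRE-sampling symbol, frequency by frequency, uniformly in `L`

Width seat `pub-ymgap-dag-n07-w7` (g4), `--supports stmt-QuantumFields-26907 --as helper`; count-neutral; 0 `def`.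
Road item (L1) of dag-n07-w5's `LOCATED-PD-LOCALIZATION-ROAD.md` §3 (the quantitative edition of this lineage's
`aliasSum_pos` ∕ `aliasSymbolK_pos`, p614581); part 1 (`…N07AliasSumMarginCore`) is the abstract margin `aliasCore_margin`.

THE TWO FORMS.  At one averaging level with odd block side `L`, block momentum `θ` (coordinates `θ_κ ∉ 2πℤ` collected in `J`)
and alias data `s_m(ϑ) = sin((ϑ + 2πm)∕(2L))`, `m < L`, the CENTRE form and the MATCHED (block-mean, `|u|²`-weighted,
[B6] (2.22)) form have the symbols
`K(θ)  = L^{−|J|}  Σ_{m ∈ [L]^J} Π_κ [(−1)^{m_κ} sin(θ_κ∕2) ∕ s_{m_κ}(θ_κ)] · (4 Σ_κ s_{m_κ}(θ_κ)²)^{−2}` (`> 0`, `aliasSymbolK_pos`),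
`K₀(θ) = L^{−2|J|} Σ_{m ∈ [L]^J} Π_κ [sin²(θ_κ∕2) ∕ s_{m_κ}(θ_κ)²] · (4 Σ_κ s_{m_κ}(θ_κ)²)^{−2}`.
THIS FILE proves ★★★ `matchedSymbol_le_aliasSymbolK`: `K₀(θ) ≤ π^{|J|} · K(θ)` for odd `L ≥ 3`, every finite `J`, every
`θ ∈ (0,2π)^J` — n07-w5's (★)₁ with the explicit constant `c₁ = π^{−|J|} ≥ π^{−d}`, INDEPENDENT of `L` and of the coarse torus.
§4 the sine data: for `θ_κ ∈ (0,π]` the minimum of `m ↦ s_m` is `s_0` and `s_1 ≥ 2 s_0` (`sin 3x ≥ 2 sin x` on `[0,π∕6]`);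
for `θ_κ ∈ [π,2π)` the mirror statements at the end `L−1` (reflection `m ↦ L−1−m`, `ϑ ↦ 2π − ϑ`); `L·s_e ≤ (π∕2)·sin(θ_κ∕2)`
(Jordan, `Real.mul_le_sin`); and `Σ_m s_m⁻² = L²∕sin²(θ_κ∕2)` (`Literature.MathematicalPhysics.QuantumFieldTheory.King1986.sum_inv_sin_sq` BY NAME —
the `L`-free constant is dag-n07-w5 g2's located OFFER (iii), cell bus 2026-08-28 10:08Z).  §5 the one-coordinate domination
constant ★★ `sineAlias_domination` (`w = sin(ϑ∕2)∕(πL)`), ★★★ `aliasSum_margin` (`F = x⁻¹·x⁻¹` in `aliasCore_margin`) and the display.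

LOCATED, NOT CLAIMED (in-seat numerics, desk note `pub-ymgap-dag-n07-w7/LOCATED-SHARP-MARGIN.md`): the true ratio `K∕K₀`
appears to be `≥ 1` (equality only as `θ → 0`); the sharp form needs, per coordinate and for all `t ≥ 0`,
`L Σ_m (−1)^m e^{−t s_m²}∕s_m ≥ sin(θ∕2) Σ_m e^{−t s_m²}∕s_m²` (an identity at `t = 0`) — NOT proved here.

HONEST SCOPE.  Elementary trigonometry + part 1 ([folklore] throughout); nothing of [B11]∕[B6]∕[3] is asserted; road items (L2)
(discrete Caccioppoli for the clamped bilaplacian), (L4) (assembly) and the multi-level `(P)_D` for Bałaban's `d = 4` geometries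
stay OPEN; `hker`, stub 1, K0⁷∕K1⁸ NOT closed; N07 not discharged; nothing continuum ∕ OS ∕ mass gap ∕ Clay.  Context:
T. Bałaban, CMP **96** (1984) 223–250 [Balaban1984PropagatorsII] (2.22) p.226; CMP **109** (1987) [Balaban1987RG1] (0.4) p.253
(block centres ⇒ odd `L`) — nothing is cited as a hypothesis.
-/

set_option autoImplicit false

noncomputable section

open Finset

namespace Summit.QuantumFields.YangMills.Theorems.N07AliasSumMargin

open Summit.QuantumFields.YangMills.Theorems.N07AliasSumPositivity

/-! ## §4  The sine data: end minimum, doubling at the neighbour, and `sin(ϑ∕2) ≤ L·s_e` -/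

section Sine

open Real

/-- The REFLECTION of the alias angles: `(ϑ + 2πm)∕(2L) = π − ((2π − ϑ) + 2π(L−1−m))∕(2L)` for `m < L`. [folklore] -/
theorem aliasAngle_reflect (ϑ : ℝ) {L m : ℕ} (hm : m < L) :
    (ϑ + 2 * π * m) / (2 * L) = π - ((2 * π - ϑ) + 2 * π * (L - 1 - m : ℕ)) / (2 * L) := by
  have hL : (L : ℝ) ≠ 0 := by exact_mod_cast (show L ≠ 0 by omega)
  have hcast : ((L - 1 - m : ℕ) : ℝ) = (L : ℝ) - 1 - m := by
    rw [Nat.cast_sub (by omega), Nat.cast_sub (by omega), Nat.cast_one]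
  rw [hcast]
  field_simp
  ring

/-- The alias data under the reflection: `sin((ϑ + 2πm)∕(2L)) = sin(((2π − ϑ) + 2π(L−1−m))∕(2L))`, `m < L`. [folklore] -/
theorem sineAlias_reflect (ϑ : ℝ) {L m : ℕ} (hm : m < L) :
    sin ((ϑ + 2 * π * m) / (2 * L)) = sin (((2 * π - ϑ) + 2 * π * (L - 1 - m : ℕ)) / (2 * L)) := by
  rw [aliasAngle_reflect ϑ hm, sin_pi_sub]

/-- LEFT END MINIMUM: for `ϑ ∈ (0, π]` and `m < L`, `sin(ϑ∕(2L)) ≤ sin((ϑ + 2πm)∕(2L))` (the two angles sum to at most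
`π`). [folklore] -/
theorem sineAlias_min_left {ϑ : ℝ} (h0 : 0 < ϑ) (h1 : ϑ ≤ π) {L m : ℕ} (hm : m < L) :
    sin (ϑ / (2 * L)) ≤ sin ((ϑ + 2 * π * m) / (2 * L)) := by
  have hL1 : (1 : ℝ) ≤ L := by exact_mod_cast (show 1 ≤ L by omega)
  have h2L : (0 : ℝ) < 2 * L := by positivity
  have hmL : (m : ℝ) ≤ L - 1 := by
    have : ((m + 1 : ℕ) : ℝ) ≤ L := by exact_mod_cast hm
    push_cast at this; linarith
  have hA0 : 0 < ϑ / (2 * L) := by positivity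
  have hAB : ϑ / (2 * L) ≤ (ϑ + 2 * π * m) / (2 * L) :=
    div_le_div_of_nonneg_right (by nlinarith [pi_pos, (Nat.cast_nonneg m : (0 : ℝ) ≤ m)]) h2L.le
  have hsum : ϑ / (2 * L) + (ϑ + 2 * π * m) / (2 * L) ≤ π := by
    rw [← add_div, div_le_iff₀ h2L]
    nlinarith [pi_pos]
  have hBπ : (ϑ + 2 * π * m) / (2 * L) < π := (aliasAngle_mem h0 (by linarith [pi_pos]) hm).2
  by_cases hB : (ϑ + 2 * π * m) / (2 * L) ≤ π / 2
  · exact sin_le_sin_of_le_of_le_pi_div_two (by linarith) hB hAB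
  · push Not at hB
    rw [← sin_pi_sub ((ϑ + 2 * π * m) / (2 * L))]
    exact sin_le_sin_of_le_of_le_pi_div_two (by linarith) (by linarith) (by linarith)

/-- RIGHT END MINIMUM: for `ϑ ∈ [π, 2π)` and `m < L`, `sin((ϑ + 2π(L−1))∕(2L)) ≤ sin((ϑ + 2πm)∕(2L))` (the left
statement at `2π − ϑ` under the reflection). [folklore] -/
theorem sineAlias_min_right {ϑ : ℝ} (h0 : π ≤ ϑ) (h1 : ϑ < 2 * π) {L m : ℕ} (hm : m < L) :
    sin ((ϑ + 2 * π * (L - 1 : ℕ)) / (2 * L)) ≤ sin ((ϑ + 2 * π * m) / (2 * L)) := by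
  have hL : L - 1 < L := by omega
  rw [sineAlias_reflect ϑ hL, sineAlias_reflect ϑ hm, show L - 1 - (L - 1) = 0 by omega, Nat.cast_zero, mul_zero,
    add_zero]
  exact sineAlias_min_left (by linarith) (by linarith) (by omega)

/-- ★ LEFT END DOUBLING: for `ϑ ∈ (0, π]` and `L ≥ 3`, `2·sin(ϑ∕(2L)) ≤ sin((ϑ + 2π)∕(2L))`
(`x := ϑ∕(2L) ≤ π∕6`, `sin 3x = 3 sin x − 4 sin³x ≥ 2 sin x`, and `3x ≤ (ϑ+2π)∕(2L) ≤ π∕2`). [folklore] -/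
theorem sineAlias_double_left {ϑ : ℝ} (h0 : 0 < ϑ) (h1 : ϑ ≤ π) {L : ℕ} (h3 : 3 ≤ L) :
    2 * sin (ϑ / (2 * L)) ≤ sin ((ϑ + 2 * π) / (2 * L)) := by
  have hL3 : (3 : ℝ) ≤ L := by exact_mod_cast h3
  have h2L : (0 : ℝ) < 2 * L := by positivity
  set x := ϑ / (2 * L) with hx
  have hx0 : 0 ≤ x := by positivity
  have hx6 : x ≤ π / 6 := by
    rw [hx, div_le_iff₀ h2L]; nlinarith [pi_pos]
  have h3x : 3 * x ≤ (ϑ + 2 * π) / (2 * L) := by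
    rw [hx, ← mul_div_assoc, div_le_div_iff_of_pos_right h2L]; nlinarith [pi_pos]
  have hB : (ϑ + 2 * π) / (2 * L) ≤ π / 2 := by
    rw [div_le_iff₀ h2L]; nlinarith [pi_pos]
  have hsinx0 : 0 ≤ sin x := sin_nonneg_of_nonneg_of_le_pi hx0 (by linarith [pi_pos])
  have hsinx : sin x ≤ 1 / 2 := by
    rw [← sin_pi_div_six]
    exact sin_le_sin_of_le_of_le_pi_div_two (by linarith [pi_pos]) (by linarith [pi_pos]) hx6
  have hstep : 2 * sin x ≤ sin (3 * x) := by
    rw [sin_three_mul]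
    nlinarith [mul_nonneg hsinx0 (mul_nonneg (sub_nonneg.2 hsinx) (by linarith : (0 : ℝ) ≤ 1 / 2 + sin x))]
  exact hstep.trans (sin_le_sin_of_le_of_le_pi_div_two (by linarith [pi_pos]) hB h3x)

/-- ★ RIGHT END DOUBLING: for `ϑ ∈ [π, 2π)` and `L ≥ 3`, `2·sin((ϑ + 2π(L−1))∕(2L)) ≤ sin((ϑ + 2π(L−2))∕(2L))`.
[folklore] -/
theorem sineAlias_double_right {ϑ : ℝ} (h0 : π ≤ ϑ) (h1 : ϑ < 2 * π) {L : ℕ} (h3 : 3 ≤ L) :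
    2 * sin ((ϑ + 2 * π * (L - 1 : ℕ)) / (2 * L)) ≤ sin ((ϑ + 2 * π * (L - 2 : ℕ)) / (2 * L)) := by
  have hL : L - 1 < L := by omega
  have hL' : L - 2 < L := by omega
  rw [sineAlias_reflect ϑ hL, sineAlias_reflect ϑ hL', show L - 1 - (L - 1) = 0 by omega,
    show L - 1 - (L - 2) = 1 by omega, Nat.cast_zero, mul_zero, add_zero, Nat.cast_one, mul_one]
  exact sineAlias_double_left (by linarith) (by linarith) h3

/-- JORDAN AT THE LEFT END: `L · sin(ϑ∕(2L)) ≤ (π∕2) · sin(ϑ∕2)` for `ϑ ∈ [0, π]` (`sin u ≤ u` at `u = ϑ∕(2L)` and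
`(2∕π)·(ϑ∕2) ≤ sin(ϑ∕2)`, `Real.mul_le_sin`). [folklore] -/
theorem mul_sineAlias_left_le {ϑ : ℝ} (h0 : 0 ≤ ϑ) (h1 : ϑ ≤ π) {L : ℕ} (hL : 1 ≤ L) :
    L * sin (ϑ / (2 * L)) ≤ π / 2 * sin (ϑ / 2) := by
  have hL1 : (1 : ℝ) ≤ L := by exact_mod_cast hL
  have hu : 0 ≤ ϑ / (2 * L) := by positivity
  have h1' : sin (ϑ / (2 * L)) ≤ ϑ / (2 * L) := sin_le hu
  have h2' : 2 / π * (ϑ / 2) ≤ sin (ϑ / 2) := mul_le_sin (by positivity) (by linarith)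
  have e : (L : ℝ) * (ϑ / (2 * L)) = ϑ / 2 := by field_simp
  have hπ := pi_pos
  calc (L : ℝ) * sin (ϑ / (2 * L)) ≤ L * (ϑ / (2 * L)) := mul_le_mul_of_nonneg_left h1' (by positivity)
    _ = π / 2 * (2 / π * (ϑ / 2)) := by rw [e]; field_simp
    _ ≤ π / 2 * sin (ϑ / 2) := mul_le_mul_of_nonneg_left h2' (by positivity)

/-- JORDAN AT THE RIGHT END: `L · sin((ϑ + 2π(L−1))∕(2L)) ≤ (π∕2) · sin(ϑ∕2)` for `ϑ ∈ [π, 2π]` (the left statement at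
`2π − ϑ`). [folklore] -/
theorem mul_sineAlias_right_le {ϑ : ℝ} (h0 : π ≤ ϑ) (h1 : ϑ ≤ 2 * π) {L : ℕ} (hL : 1 ≤ L) :
    L * sin ((ϑ + 2 * π * (L - 1 : ℕ)) / (2 * L)) ≤ π / 2 * sin (ϑ / 2) := by
  have hL' : L - 1 < L := by omega
  rw [sineAlias_reflect ϑ hL', show L - 1 - (L - 1) = 0 by omega, Nat.cast_zero, mul_zero, add_zero]
  have e : sin (ϑ / 2) = sin ((2 * π - ϑ) / 2) := by
    rw [show (2 * π - ϑ) / 2 = π - ϑ / 2 by ring, sin_pi_sub]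
  rw [e]
  exact mul_sineAlias_left_le (by linarith) (by linarith) hL

/-- KING'S ALIASING IDENTITY in the alias-angle letters: `Σ_{m<L} sin((ϑ + 2πm)∕(2L))⁻² = L² ∕ sin²(ϑ∕2)` for
`sin(ϑ∕2) ≠ 0` (`Literature.MathematicalPhysics.QuantumFieldTheory.King1986.sum_inv_sin_sq`, file `King1986/AliasingIdentity`, BY NAME at `θ = ϑ∕(2L)`).
[cite: King1986, p.671 (proof of Lemma 4.1, last sentence)] -/
theorem sum_inv_sineAlias_sq {ϑ : ℝ} {L : ℕ} (hL : 1 ≤ L) (hϑ : sin (ϑ / 2) ≠ 0) :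
    ∑ m ∈ range L, (sin ((ϑ + 2 * π * m) / (2 * L)) ^ 2)⁻¹ = (L : ℝ) ^ 2 / sin (ϑ / 2) ^ 2 := by
  have hL0 : L ≠ 0 := by omega
  have hLr : (L : ℝ) ≠ 0 := by exact_mod_cast hL0
  have e : (L : ℝ) * (ϑ / (2 * L)) = ϑ / 2 := by field_simp
  have h := Literature.MathematicalPhysics.QuantumFieldTheory.King1986.sum_inv_sin_sq hL0
    (θ := ϑ / (2 * L)) (by rw [e]; exact hϑ)
  rw [e] at h
  rw [← h]
  refine sum_congr rfl (fun m _ => ?_)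
  have harg : (ϑ + 2 * π * m) / (2 * L) = ϑ / (2 * L) + m * π / L := by ring
  rw [harg]

end Sine

/-! ## §5  The explicit margin for the sine data -/

/-- ★★ **The one-coordinate domination constant of the sine data is `sin(ϑ∕2)∕(πL)`.**  For odd `L ≥ 3`, `ϑ ∈ (0,2π)`,
`G ∈ iterMono 1` and `x ≥ 0`, with `s_m = sin((ϑ + 2πm)∕(2L))`:
`(sin(ϑ∕2)∕(πL)) · Σ_{m<L} G(x + s_m²)∕s_m² ≤ transfer L s G x` — `matchedSum_le_transfer` at the end `e = 0` (`ϑ ≤ π`) or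
`e = L−1` (`ϑ ≥ π`), King's identity `Σ_m s_m⁻² = L²∕sin²(ϑ∕2)` and Jordan `L s_e ≤ (π∕2) sin(ϑ∕2)` (dag-n07-w5 g2's located
OFFER (iii)). [folklore] -/
theorem sineAlias_domination {L : ℕ} (hL : Odd L) (h3 : 3 ≤ L) {ϑ : ℝ} (h0 : 0 < ϑ) (h1 : ϑ < 2 * Real.pi)
    {G : ℝ → ℝ} (hG : G ∈ iterMono 1) {x : ℝ} (hx : 0 ≤ x) :
    Real.sin (ϑ / 2) / (Real.pi * L) *
        ∑ m ∈ range L, G (x + Real.sin ((ϑ + 2 * Real.pi * m) / (2 * L)) ^ 2) /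
          Real.sin ((ϑ + 2 * Real.pi * m) / (2 * L)) ^ 2
      ≤ transfer L (fun m => Real.sin ((ϑ + 2 * Real.pi * m) / (2 * L))) G x := by
  have hL1 : 1 ≤ L := by omega
  have hLpos : (0 : ℝ) < L := by exact_mod_cast (show 0 < L by omega)
  set s : ℕ → ℝ := fun m => Real.sin ((ϑ + 2 * Real.pi * m) / (2 * L)) with hsdef
  have hs0 : ∀ m, m < L → 0 < s m := fun m hm => sineAlias_pos h0 h1 hm
  obtain ⟨p, hp⟩ := sineAlias_hill h0 h1 L
  have hsin : 0 < Real.sin (ϑ / 2) := Real.sin_pos_of_pos_of_lt_pi (by linarith) (by linarith)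
  have hZ : ∑ m ∈ range L, (s m ^ 2)⁻¹ = (L : ℝ) ^ 2 / Real.sin (ϑ / 2) ^ 2 := sum_inv_sineAlias_sq hL1 hsin.ne'
  -- the end, its doubling neighbour and Jordan, according to `ϑ ≤ π`
  obtain ⟨e, e', he, hmin, h2, hJ⟩ : ∃ e e' : ℕ, ((e = 0 ∧ e' = 1) ∨ (e = L - 1 ∧ e' = L - 2)) ∧
      (∀ m, m < L → s e ≤ s m) ∧ 2 * s e ≤ s e' ∧ (L : ℝ) * s e ≤ Real.pi / 2 * Real.sin (ϑ / 2) := by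
    by_cases h : ϑ ≤ Real.pi
    · refine ⟨0, 1, Or.inl ⟨rfl, rfl⟩, ?_, ?_, ?_⟩
      · intro m hm
        simp only [hsdef, Nat.cast_zero, mul_zero, add_zero]
        exact sineAlias_min_left h0 h hm
      · simp only [hsdef, Nat.cast_zero, mul_zero, add_zero, Nat.cast_one, mul_one]
        exact sineAlias_double_left h0 h h3
      · simp only [hsdef, Nat.cast_zero, mul_zero, add_zero]
        exact mul_sineAlias_left_le h0.le h hL1
    · have h' : Real.pi ≤ ϑ := le_of_not_ge h
      refine ⟨L - 1, L - 2, Or.inr ⟨rfl, rfl⟩, ?_, ?_, ?_⟩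
      · intro m hm
        exact sineAlias_min_right h' h1 hm
      · exact sineAlias_double_right h' h1 h3
      · exact mul_sineAlias_right_le h' h1.le hL1
  have heL : e < L := by rcases he with ⟨h, _⟩ | ⟨h, _⟩ <;> omega
  have hse := hs0 e heL
  have hM := matchedSum_le_transfer hL h3 hs0 hp he hmin h2 hG hx
  rw [hZ] at hM
  -- `2 s_e L² ∕ sin² ≤ πL ∕ sin`
  have hT0 : 0 ≤ transfer L s G x := by
    have := transfer_pos hL hs0 hp hG hx
    exact this.le
  have hc : 2 * s e * ((L : ℝ) ^ 2 / Real.sin (ϑ / 2) ^ 2) ≤ Real.pi * L / Real.sin (ϑ / 2) := by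
    rw [show 2 * s e * ((L : ℝ) ^ 2 / Real.sin (ϑ / 2) ^ 2) = (2 * ((L : ℝ) * s e)) * L / Real.sin (ϑ / 2) ^ 2 by ring,
      div_le_div_iff₀ (by positivity) hsin, show Real.sin (ϑ / 2) ^ 2 = Real.sin (ϑ / 2) * Real.sin (ϑ / 2) by ring]
    have := mul_le_mul_of_nonneg_right hJ (by positivity : (0 : ℝ) ≤ 2 * L * Real.sin (ϑ / 2))
    nlinarith [this]
  have hM' : ∑ m ∈ range L, G (x + s m ^ 2) / s m ^ 2 ≤ Real.pi * L / Real.sin (ϑ / 2) * transfer L s G x :=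
    hM.trans (mul_le_mul_of_nonneg_right hc hT0)
  have hπL : 0 < Real.pi * L := by positivity
  calc Real.sin (ϑ / 2) / (Real.pi * L) * ∑ m ∈ range L, G (x + s m ^ 2) / s m ^ 2
      ≤ Real.sin (ϑ / 2) / (Real.pi * L) * (Real.pi * L / Real.sin (ϑ / 2) * transfer L s G x) :=
        mul_le_mul_of_nonneg_left hM' (by positivity)
    _ = transfer L s G x := by field_simp

/-- ★★★ **The explicit one-level margin (core form), uniform in `L`.**  For a finite set `J` of coordinates, block momenta
`θ_κ ∈ (0, 2π)` and ODD block side `L ≥ 3`, with `s_{m}(ϑ) = sin((ϑ + 2πm)∕(2L))`: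
`(Π_κ sin(θ_κ∕2)) · Σ_{m : J → Fin L} (Π_κ s_{m_κ}(θ_κ)⁻²) ∕ (Σ_κ s_{m_κ}(θ_κ)²)²
   ≤ (πL)^{|J|} · Σ_m (Π_κ (−1)^{m_κ} ∕ s_{m_κ}(θ_κ)) ∕ (Σ_κ s_{m_κ}(θ_κ)²)²`
(`aliasCore_margin` with `F = x⁻¹·x⁻¹` and the constants `sineAlias_domination`). [folklore] -/
theorem aliasSum_margin {J : Type*} [Fintype J] [DecidableEq J] {L : ℕ} (hL : Odd L) (h3 : 3 ≤ L) (θ : J → ℝ)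
    (hθ : ∀ κ, 0 < θ κ ∧ θ κ < 2 * Real.pi) :
    (∏ κ, Real.sin (θ κ / 2)) * ∑ m : J → Fin L,
        (∏ κ, (Real.sin ((θ κ + 2 * Real.pi * (m κ : ℕ)) / (2 * L)) ^ 2)⁻¹) /
          (∑ κ, Real.sin ((θ κ + 2 * Real.pi * (m κ : ℕ)) / (2 * L)) ^ 2) ^ 2
      ≤ (Real.pi * L) ^ Fintype.card J * ∑ m : J → Fin L,
        (∏ κ, (-1 : ℝ) ^ (m κ : ℕ) / Real.sin ((θ κ + 2 * Real.pi * (m κ : ℕ)) / (2 * L))) /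
          (∑ κ, Real.sin ((θ κ + 2 * Real.pi * (m κ : ℕ)) / (2 * L)) ^ 2) ^ 2 := by
  classical
  have hLpos : (0 : ℝ) < L := by exact_mod_cast (show 0 < L by omega)
  -- the data and the constants
  set s : J → ℕ → ℝ := fun κ m => Real.sin ((θ κ + 2 * Real.pi * m) / (2 * L)) with hsdef
  have hs0 : ∀ κ m, m < L → 0 < s κ m := fun κ m hm => sineAlias_pos (hθ κ).1 (hθ κ).2 hm
  have hs : ∀ κ, ∃ p, ((∀ m m', m ≤ m' → m' ≤ p → m' < L → s κ m ≤ s κ m') ∧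
      (∀ m m', p + 1 ≤ m → m ≤ m' → m' < L → s κ m' ≤ s κ m)) :=
    fun κ => sineAlias_hill (hθ κ).1 (hθ κ).2 L
  set w : J → ℝ := fun κ => Real.sin (θ κ / 2) / (Real.pi * L) with hwdef
  have hsinpos : ∀ κ, 0 < Real.sin (θ κ / 2) := fun κ =>
    Real.sin_pos_of_pos_of_lt_pi (by linarith [(hθ κ).1]) (by linarith [(hθ κ).2])
  have hw0 : ∀ κ, 0 ≤ w κ := fun κ => div_nonneg (hsinpos κ).le (by positivity)
  have hw : ∀ κ (G : ℝ → ℝ), G ∈ iterMono 1 → ∀ x : ℝ, 0 ≤ x →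
      w κ * ∑ m ∈ range L, G (x + s κ m ^ 2) / s κ m ^ 2 ≤ transfer L (s κ) G x :=
    fun κ G hG x hx => sineAlias_domination hL h3 (hθ κ).1 (hθ κ).2 hG hx
  -- the abstract margin at `x = 0`
  have hcore := aliasCore_margin hL s hs0 hs w hw0 hw (fun x => x⁻¹ * x⁻¹) iterMono_inv_mul_inv 0 le_rfl
  simp only [zero_add] at hcore
  -- rewrite the two sums of the statement in the abstract shape
  have eB : ∑ m : J → Fin L, (∏ κ, (Real.sin ((θ κ + 2 * Real.pi * (m κ : ℕ)) / (2 * L)) ^ 2)⁻¹) /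
        (∑ κ, Real.sin ((θ κ + 2 * Real.pi * (m κ : ℕ)) / (2 * L)) ^ 2) ^ 2
      = ∑ m : J → Fin L, (∏ κ, (s κ (m κ) ^ 2)⁻¹) *
          ((∑ κ, s κ (m κ) ^ 2)⁻¹ * (∑ κ, s κ (m κ) ^ 2)⁻¹) := by
    refine Fintype.sum_congr _ _ (fun m => ?_)
    simp only [hsdef, div_eq_mul_inv, sq, mul_inv]
  have eA : ∑ m : J → Fin L, (∏ κ, (-1 : ℝ) ^ (m κ : ℕ) / Real.sin ((θ κ + 2 * Real.pi * (m κ : ℕ)) / (2 * L))) /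
        (∑ κ, Real.sin ((θ κ + 2 * Real.pi * (m κ : ℕ)) / (2 * L)) ^ 2) ^ 2
      = ∑ m : J → Fin L, (∏ κ, (-1 : ℝ) ^ (m κ : ℕ) / s κ (m κ)) *
          ((∑ κ, s κ (m κ) ^ 2)⁻¹ * (∑ κ, s κ (m κ) ^ 2)⁻¹) := by
    refine Fintype.sum_congr _ _ (fun m => ?_)
    simp only [hsdef, div_eq_mul_inv, sq, mul_inv]
  rw [eB, eA]
  -- the weights: `Π w = (Π sin) ∕ (πL)^{|J|}`
  have hwprod : (∏ κ, w κ) = (∏ κ, Real.sin (θ κ / 2)) / (Real.pi * L) ^ Fintype.card J := by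
    rw [hwdef, Finset.prod_div_distrib, Finset.prod_const, Finset.card_univ]
  rw [hwprod, div_mul_eq_mul_div, div_le_iff₀ (by positivity)] at hcore
  linarith [hcore]

/-- ★★★ **«`K₀(θ) ≤ π^{|J|} · K(θ)`»: the block-MEAN symbol against the CENTRE-sampling symbol of
`aliasSymbolK_pos`, letter for letter, uniformly in `L` and in the coarse torus.**  For a finite set `J` of coordinates,
`θ_κ ∈ (0,2π)` and odd `L ≥ 3`:
`L^{−2|J|} Σ_m Π_κ [sin²(θ_κ∕2) ∕ s_{m_κ}(θ_κ)²] · (4 Σ_κ s²)^{−2}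
   ≤ π^{|J|} · L^{−|J|} Σ_m Π_κ [(−1)^{m_κ} sin(θ_κ∕2) ∕ s_{m_κ}(θ_κ)] · (4 Σ_κ s²)^{−2}` —
the one-level margin (★)₁ of the localisation road with the explicit constant `π^{−|J|} ≥ π^{−d}`. [folklore] -/
theorem matchedSymbol_le_aliasSymbolK {J : Type*} [Fintype J] [DecidableEq J] {L : ℕ} (hL : Odd L) (h3 : 3 ≤ L)
    (θ : J → ℝ) (hθ : ∀ κ, 0 < θ κ ∧ θ κ < 2 * Real.pi) :
    ((L : ℝ) ^ (2 * Fintype.card J))⁻¹ * ∑ m : J → Fin L,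
        (∏ κ, Real.sin (θ κ / 2) ^ 2 / Real.sin ((θ κ + 2 * Real.pi * (m κ : ℕ)) / (2 * L)) ^ 2) /
          (4 * ∑ κ, Real.sin ((θ κ + 2 * Real.pi * (m κ : ℕ)) / (2 * L)) ^ 2) ^ 2
      ≤ Real.pi ^ Fintype.card J * (((L : ℝ) ^ Fintype.card J)⁻¹ * ∑ m : J → Fin L,
        (∏ κ, (-1 : ℝ) ^ (m κ : ℕ) * Real.sin (θ κ / 2) / Real.sin ((θ κ + 2 * Real.pi * (m κ : ℕ)) / (2 * L))) /
          (4 * ∑ κ, Real.sin ((θ κ + 2 * Real.pi * (m κ : ℕ)) / (2 * L)) ^ 2) ^ 2) := by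
  have hLpos : (0 : ℝ) < L := by exact_mod_cast (show 0 < L by omega)
  have hsin : 0 ≤ ∏ κ : J, Real.sin (θ κ / 2) :=
    Finset.prod_nonneg (fun κ _ => (Real.sin_pos_of_pos_of_lt_pi (by linarith [(hθ κ).1])
      (by linarith [(hθ κ).2])).le)
  -- factor the common prefactors out of both symbols
  have keyB : ∀ m : J → Fin L,
      (∏ κ, Real.sin (θ κ / 2) ^ 2 / Real.sin ((θ κ + 2 * Real.pi * (m κ : ℕ)) / (2 * L)) ^ 2) /
        (4 * ∑ κ, Real.sin ((θ κ + 2 * Real.pi * (m κ : ℕ)) / (2 * L)) ^ 2) ^ 2 =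
      ((∏ κ : J, Real.sin (θ κ / 2)) * (∏ κ : J, Real.sin (θ κ / 2)) / 16) *
        ((∏ κ, (Real.sin ((θ κ + 2 * Real.pi * (m κ : ℕ)) / (2 * L)) ^ 2)⁻¹) /
          (∑ κ, Real.sin ((θ κ + 2 * Real.pi * (m κ : ℕ)) / (2 * L)) ^ 2) ^ 2) := by
    intro m
    have e : (∏ κ, Real.sin (θ κ / 2) ^ 2 / Real.sin ((θ κ + 2 * Real.pi * (m κ : ℕ)) / (2 * L)) ^ 2)
        = (∏ κ : J, Real.sin (θ κ / 2)) * (∏ κ : J, Real.sin (θ κ / 2)) *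
          ∏ κ, (Real.sin ((θ κ + 2 * Real.pi * (m κ : ℕ)) / (2 * L)) ^ 2)⁻¹ := by
      rw [← Finset.prod_mul_distrib, ← Finset.prod_mul_distrib]
      exact Finset.prod_congr rfl (fun κ _ => by rw [div_eq_mul_inv, sq])
    rw [e]
    ring
  have keyA : ∀ m : J → Fin L,
      (∏ κ, (-1 : ℝ) ^ (m κ : ℕ) * Real.sin (θ κ / 2) / Real.sin ((θ κ + 2 * Real.pi * (m κ : ℕ)) / (2 * L))) /
        (4 * ∑ κ, Real.sin ((θ κ + 2 * Real.pi * (m κ : ℕ)) / (2 * L)) ^ 2) ^ 2 =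
      ((∏ κ : J, Real.sin (θ κ / 2)) / 16) *
        ((∏ κ, (-1 : ℝ) ^ (m κ : ℕ) / Real.sin ((θ κ + 2 * Real.pi * (m κ : ℕ)) / (2 * L))) /
          (∑ κ, Real.sin ((θ κ + 2 * Real.pi * (m κ : ℕ)) / (2 * L)) ^ 2) ^ 2) := by
    intro m
    have e : (∏ κ, (-1 : ℝ) ^ (m κ : ℕ) * Real.sin (θ κ / 2) / Real.sin ((θ κ + 2 * Real.pi * (m κ : ℕ)) / (2 * L)))
        = (∏ κ : J, Real.sin (θ κ / 2)) *
          ∏ κ, (-1 : ℝ) ^ (m κ : ℕ) / Real.sin ((θ κ + 2 * Real.pi * (m κ : ℕ)) / (2 * L)) := by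
      rw [← Finset.prod_mul_distrib]
      exact Finset.prod_congr rfl (fun κ _ => by ring)
    rw [e]
    ring
  simp only [keyB, keyA, ← Finset.mul_sum]
  have hmar := aliasSum_margin hL h3 θ hθ
  -- abbreviate the two core sums
  set A := ∑ m : J → Fin L,
    (∏ κ, (-1 : ℝ) ^ (m κ : ℕ) / Real.sin ((θ κ + 2 * Real.pi * (m κ : ℕ)) / (2 * L))) /
      (∑ κ, Real.sin ((θ κ + 2 * Real.pi * (m κ : ℕ)) / (2 * L)) ^ 2) ^ 2 with hA
  set B := ∑ m : J → Fin L, (∏ κ, (Real.sin ((θ κ + 2 * Real.pi * (m κ : ℕ)) / (2 * L)) ^ 2)⁻¹) /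
      (∑ κ, Real.sin ((θ κ + 2 * Real.pi * (m κ : ℕ)) / (2 * L)) ^ 2) ^ 2 with hB
  set P := ∏ κ : J, Real.sin (θ κ / 2) with hP
  have hLJ : (0 : ℝ) < (L : ℝ) ^ Fintype.card J := by positivity
  -- multiply the core margin by `P ∕ (16 L^{2|J|}) ≥ 0`
  have h1 : ((L : ℝ) ^ (2 * Fintype.card J))⁻¹ * (P * P / 16 * B)
      = (P / 16 * ((L : ℝ) ^ (2 * Fintype.card J))⁻¹) * (P * B) := by ring
  have h2 : Real.pi ^ Fintype.card J * (((L : ℝ) ^ Fintype.card J)⁻¹ * (P / 16 * A))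
      = (P / 16 * ((L : ℝ) ^ (2 * Fintype.card J))⁻¹) * ((Real.pi * L) ^ Fintype.card J * A) := by
    have hx : ((L : ℝ) ^ Fintype.card J)⁻¹ * (L : ℝ) ^ Fintype.card J = 1 := inv_mul_cancel₀ hLJ.ne'
    rw [pow_mul', mul_pow, sq, mul_inv]
    linear_combination (-(P / 16 * Real.pi ^ Fintype.card J * A * ((L : ℝ) ^ Fintype.card J)⁻¹)) * hx
  rw [h1, h2]
  exact mul_le_mul_of_nonneg_left hmar (by positivity)

/-- The same margin with the DIMENSION-uniform constant: for `|J| ≤ d` (a sector of a `d`-dimensional momentum),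
`K₀(θ) ≤ π^d · K(θ)` (`π^{|J|} ≤ π^d` and `K(θ) > 0` by `aliasSymbolK_pos`). [folklore] -/
theorem matchedSymbol_le_aliasSymbolK_of_card_le {J : Type*} [Fintype J] [DecidableEq J] [Nonempty J] {L : ℕ}
    (hL : Odd L) (h3 : 3 ≤ L) (θ : J → ℝ) (hθ : ∀ κ, 0 < θ κ ∧ θ κ < 2 * Real.pi) {d : ℕ}
    (hJ : Fintype.card J ≤ d) :
    ((L : ℝ) ^ (2 * Fintype.card J))⁻¹ * ∑ m : J → Fin L,
        (∏ κ, Real.sin (θ κ / 2) ^ 2 / Real.sin ((θ κ + 2 * Real.pi * (m κ : ℕ)) / (2 * L)) ^ 2) /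
          (4 * ∑ κ, Real.sin ((θ κ + 2 * Real.pi * (m κ : ℕ)) / (2 * L)) ^ 2) ^ 2
      ≤ Real.pi ^ d * (((L : ℝ) ^ Fintype.card J)⁻¹ * ∑ m : J → Fin L,
        (∏ κ, (-1 : ℝ) ^ (m κ : ℕ) * Real.sin (θ κ / 2) / Real.sin ((θ κ + 2 * Real.pi * (m κ : ℕ)) / (2 * L))) /
          (4 * ∑ κ, Real.sin ((θ κ + 2 * Real.pi * (m κ : ℕ)) / (2 * L)) ^ 2) ^ 2) := by
  have hK := aliasSymbolK_pos hL θ hθ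
  have hπ : Real.pi ^ Fintype.card J ≤ Real.pi ^ d :=
    pow_le_pow_right₀ (by linarith [Real.pi_gt_three]) hJ
  exact (matchedSymbol_le_aliasSymbolK hL h3 θ hθ).trans (mul_le_mul_of_nonneg_right hπ hK.le)


end Summit.QuantumFields.YangMills.Theorems.N07AliasSumMargin

end
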